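import Literature.AlgebraicGeometry.Modules.UnitCocycleTowerLift
import Summits.HodgeConjecture.HodgeConjecture.Theorems.PadicSemiregularLiftFormalVectorBundlesAlgebraizeThickenings
import Summits.HodgeConjecture.HodgeConjecture.Theorems.FormalLiftingFromClassLifting.Negative.OneStepClassLift
import Mathlib.AlgebraicGeometry.Morphisms.Separated
import Mathlib.Data.Int.GCD

/-!
# `FormalLiftingFromClassLifting` (stmt-HodgeConjecture-13825) · weight one · Teichmüller transport

Stub `stub_teichmuellerTransport` of line `IdeatorFiveSketch` (crux `FormalLiftingFromClassLifting`,
route `PadicSemiregularLift` of `HodgeConjecture`). For a `W(k)`-scheme `𝒳` (flat and separated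
over `W = W(k)`, `k` perfect of characteristic `p ≠ 2`) with thickenings `X_n = 𝒳 ⊗ W/pⁿ` and
special fibre `X_k`, and `c ∈ Ȟ¹(X_{m+1}, 𝒪^×)`:

> if kernel classes of `Ȟ¹(X_{m+e+1}, 𝒪^×) → Ȟ¹(X_k, 𝒪^×)` extend to `X_{m+e+2}` and
> `(c|_{X_k})^{p^e N}` (`p ∤ N`) is the restriction of a class on `X_{m+e+2}`, then `c` extends to
> `X_{m+2}`.

Proof (`Literature/AlgebraicGeometry/Modules/UnitCocycle{Presented,DefectArith,TowerLift}.lean`):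
present `c` by units `G_{ab} ∈ Γ(𝒳, A_a ⊓ A_b)` on affine opens of `𝒳` (cocycle modulo `p^{m+1}`:
`G_{ab}G_{bc} = G_{ac} + p^{m+1} y₀`); for `p` odd,
`(G_{ab}G_{bc})^{p^eN} ≡ G^{p^eN}_{ac}(1 + N p^{m+e+1} ỹ)` modulo `p^{m+e+2}` where
`G_{ab}G_{bc} ≡ G_{ac}(1 + p^{m+1} ỹ)` (`exists_transport_pow`), so `T = [G^{p^eN}]` is a class
on `X_{m+e+1}` with `T|_{X_k} = (c|_{X_k})^{p^eN}`; by the hypotheses `T` extends to `X_{m+e+2}`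
(it differs from the given extendable class by a kernel class), hence
(`exists_coboundary_of_lifts`) `N ỹ` is a Čech coboundary modulo `p` on an affine refinement
(`exists_eq_add_mul_of_defect_eq`, flatness), hence so is `ỹ` (`p ∤ N`, `exists_defect_descend`),
and `c` extends (`exists_lift_of_coboundary`). No `K`-theory and no crystalline input.
-/

-- the mandated namespace `Summit.HodgeConjecture.HodgeConjecture.…` repeats a component (D-0017 layout)
set_option linter.dupNamespace false

noncomputable section

open CategoryTheory AlgebraicGeometry Limits Opposite TopologicalSpace
open Literature.AlgebraicGeometry Literature.AlgebraicGeometry.Motives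
open Literature.AlgebraicGeometry.Motives.WittScheme
open Literature.AlgebraicGeometry.Modules
open Summit.HodgeConjecture.HodgeConjecture.Theorems.FormalVectorBundlesAlgebraize
open Summit.HodgeConjecture.HodgeConjecture.Theorems.PadicPridhamSemiregularity
open Summit.HodgeConjecture.HodgeConjecture.Theorems.FormalLiftingFromClassLifting.Negative

namespace Summit.HodgeConjecture.HodgeConjecture.Theorems.FormalLiftingFromClassLifting.WeightOne

variable {p : ℕ} [Fact p.Prime] {k : Type} [Field k] (𝒳 : SchemeOver (WittVector p k))

/-! ### The tower `X_n ↪ 𝒳`: cut out by `pⁿ`, embeddings, affine intersections, indexing -/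

/-- `X_n ↪ 𝒳` is cut out by `pⁿ` on affine opens: `ι_n^♯` is onto with kernel `pⁿ Γ(𝒳, U)`
(`thickeningι_cutOut`). -/
private theorem cutOut' (n : ℕ) {U : 𝒳.left.Opens} (hU : IsAffineOpen U) :
    Function.Surjective ((thickeningι 𝒳 n).app U) ∧
      ∀ r : Γ(𝒳.left, U), (thickeningι 𝒳 n).app U r = 0 →
        ∃ c : Γ(𝒳.left, U), r = (p : Γ(𝒳.left, U)) ^ n * c := by
  refine ⟨(thickeningι_cutOut 𝒳 n hU).1, fun r hr => ?_⟩
  obtain ⟨c, hc⟩ := ((thickeningι_cutOut 𝒳 n hU).2 r).mp hr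
  exact ⟨c, by rw [hc, map_natCast, Nat.cast_pow]⟩

/-- `pⁿ = 0` on `X_n`. -/
private theorem p_pow_eq_zero (n : ℕ) (V : (thickening 𝒳 n).left.Opens) :
    (p : Γ((thickening 𝒳 n).left, V)) ^ n = 0 := by
  rw [← Nat.cast_pow]
  exact natCast_pow_eq_zero_thickening 𝒳 n V

/-- `ι_n : X_n ↪ 𝒳` is a topological embedding. -/
private theorem isInducing_ι (n : ℕ) : Topology.IsInducing (thickeningι 𝒳 n).base := by
  haveI := isClosedImmersion_thickeningι 𝒳 n
  exact (thickeningι 𝒳 n).isClosedEmbedding.isInducing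

/-- For `𝒳` separated over (the affine) `Spec W`, intersections of affine opens are affine. -/
private theorem isAffineOpen_inf [IsSeparated 𝒳.hom] (U V : 𝒳.left.Opens) (hU : IsAffineOpen U)
    (hV : IsAffineOpen V) : IsAffineOpen (U ⊓ V) :=
  (isAffineHom_diagonal_iff (f := 𝒳.hom)).mp inferInstance ⊤ (isAffineOpen_top _) U le_top V le_top
    hU hV

variable [CharP k p]

/-- `p = 0` on `X_k`. -/
private theorem p_eq_zero_special (V : (specialFibre 𝒳).left.Opens) :
    (p : Γ((specialFibre 𝒳).left, V)) = 0 := by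
  have h := natCast_eq_zero_specialFibre 𝒳 V
  rwa [pow_one] at h

/-- The special fibre indexes its points by `|X_1| ⊆ |𝒳|`. -/
private theorem exists_index_special :
    ∃ π : (specialFibre 𝒳).left → Set.range (thickeningι 𝒳 1).base,
      ∀ y, (π y : 𝒳.left) = (specialFibreι 𝒳).base y := by
  refine ⟨fun y => ⟨(specialFibreι 𝒳).base y, ?_⟩, fun y => rfl⟩
  rw [← specialFibreToThickening_ι 𝒳 0]
  exact ⟨(specialFibreToThickening 𝒳 0).base y, rfl⟩

variable [PerfectRing k p]

/-- `X_n` (`n ≠ 0`) indexes its points bijectively by `|X_1| ⊆ |𝒳|`, compatibly with `ι_n`. -/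
private theorem exists_index (n : ℕ) (hn : n ≠ 0) :
    ∃ π : (thickening 𝒳 n).left → Set.range (thickeningι 𝒳 1).base,
      (∀ y, (π y : 𝒳.left) = (thickeningι 𝒳 n).base y) ∧ Function.Bijective π := by
  have hr : Set.range (thickeningι 𝒳 n).base = Set.range (thickeningι 𝒳 1).base := by
    rw [range_thickeningι 𝒳 hn, range_thickeningι 𝒳 one_ne_zero]
  refine ⟨fun y => ⟨(thickeningι 𝒳 n).base y, hr ▸ ⟨y, rfl⟩⟩, fun y => rfl, fun y y' h => ?_, ?_⟩
  · haveI := isClosedImmersion_thickeningι 𝒳 n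
    exact (thickeningι 𝒳 n).isClosedEmbedding.injective (congrArg Subtype.val h)
  · rintro ⟨x, hx⟩
    rw [← hr] at hx
    obtain ⟨y, rfl⟩ := hx
    exact ⟨y, rfl⟩

/-! ### The stub -/

/-- **S5 (TEICHMÜLLER TRANSPORT).** For `𝒳` flat and separated over `W(k)`, `p ≠ 2`, `p ∤ N`: if
every class in `Ȟ¹(X_{m+e+1}, 𝒪^×)` dying on `X_k` extends to `X_{m+e+2}` and the `p^e N`-th power
of `c|_{X_k}` (`c ∈ Ȟ¹(X_{m+1}, 𝒪^×)`) is the restriction of a class on `X_{m+e+2}`, then `c` is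
the restriction of a class on `X_{m+2}`. The transition functions of `c`, lifted to `𝒳` on affine
opens and raised to the power `p^e N`, form a cocycle modulo `p^{m+e+1}` whose defect modulo
`p^{m+e+2}` has `N` times the reduced obstruction cochain of `c`; this class lifts by the
hypotheses, so `N` times the obstruction of `c`, hence the obstruction of `c`, is a coboundary. -/
theorem stub_teichmuellerTransport :
    ∀ (p : ℕ) [Fact p.Prime] (k : Type) [Field k] [CharP k p] [PerfectRing k p]
      (𝒳 : SchemeOver (WittVector p k)) [Flat 𝒳.hom] [IsSeparated 𝒳.hom], p ≠ 2 →
      ∀ (m e N : ℕ), ¬ p ∣ N →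
      (∀ u : CechPic (thickening 𝒳 (m + e + 1)).left,
        CechPic.pullback (specialFibreToThickening 𝒳 (m + e)) u = 1 →
        ∃ u' : CechPic (thickening 𝒳 (m + e + 2)).left,
          CechPic.pullback (thickeningMap 𝒳 (Nat.le_succ (m + e + 1))) u' = u) →
      ∀ (c : CechPic (thickening 𝒳 (m + 1)).left),
        (∃ c' : CechPic (thickening 𝒳 (m + e + 2)).left,
          CechPic.pullback (specialFibreToThickening 𝒳 (m + e + 1)) c' =
            CechPic.pullback (specialFibreToThickening 𝒳 m) c ^ (p ^ e * N)) →
        ∃ c'' : CechPic (thickening 𝒳 (m + 2)).left,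
          CechPic.pullback (thickeningMap 𝒳 (Nat.le_succ (m + 1))) c'' = c := by
  intro p _ k _ _ _ 𝒳 _ _ hp2 m e N hN h2 c hc'
  obtain ⟨c', hc'⟩ := hc'
  have hp : p.Prime := Fact.out
  -- indexings of the points of the tower by the special fibre `|X_1| ⊆ |𝒳|`
  obtain ⟨πM, hπM, hbM⟩ := exists_index 𝒳 (m + 1) (Nat.succ_ne_zero m)
  obtain ⟨σM, hσπM, hπσM⟩ := Function.bijective_iff_has_inverse.mp hbM
  obtain ⟨πT, hπT, hbT⟩ := exists_index 𝒳 (m + e + 1) (Nat.succ_ne_zero _)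
  obtain ⟨σT, -, hπσT⟩ := Function.bijective_iff_has_inverse.mp hbT
  obtain ⟨πM', hπM', -⟩ := exists_index 𝒳 (m + 2) (Nat.succ_ne_zero _)
  obtain ⟨πk, hπk⟩ := exists_index_special 𝒳
  have hπMM' : ∀ y, πM' ((thickeningMap 𝒳 (Nat.le_succ (m + 1))).base y) = πM y := fun y =>
    Subtype.ext (by rw [hπM', hπM, ← Scheme.Hom.comp_apply, thickeningMap_ι])
  have hπkT : ∀ y, πT ((specialFibreToThickening 𝒳 (m + e)).base y) = πk y := fun y =>
    Subtype.ext (by rw [hπT, hπk, ← Scheme.Hom.comp_apply, specialFibreToThickening_ι])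
  have hπkM : ∀ y, πM ((specialFibreToThickening 𝒳 m).base y) = πk y := fun y =>
    Subtype.ext (by rw [hπM, hπk, ← Scheme.Hom.comp_apply, specialFibreToThickening_ι])
  -- Step 0: present `c` along `ι_{m+1}` by units `G_{ab}` on affine opens `A_a` of `𝒳`
  obtain ⟨A, hA, memM, G, H, g, hU, hg, hmulM, hGH, hcg⟩ :=
    CechPic.exists_presentation (thickeningι 𝒳 (m + 1)) (isInducing_ι 𝒳 (m + 1))
      (fun U hU => (cutOut' 𝒳 (m + 1) hU).1) (isAffineOpen_inf 𝒳) πM σM hσπM c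
  have memS : ∀ s : Set.range (thickeningι 𝒳 1).base, (s : 𝒳.left) ∈ A s := fun s => by
    have h := memM (σM s)
    rwa [← hπM, hπσM] at h
  have memT : ∀ y, (thickeningι 𝒳 (m + e + 1)).base y ∈ A (πT y) := fun y => by
    rw [← hπT]; exact memS _
  have memk : ∀ y, (specialFibreι 𝒳).base y ∈ A (πk y) := fun y => by
    rw [← hπk]; exact memS _
  -- the cocycle identity modulo `p^{m+1}` and units modulo `p`, over affine opens `W`
  have hC : ∀ (a b d : Set.range (thickeningι 𝒳 1).base) {W : 𝒳.left.Opens} (_ : IsAffineOpen W)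
      (i₁ : W ≤ A a ⊓ A b) (i₂ : W ≤ A b ⊓ A d) (i₃ : W ≤ A a ⊓ A d), ∃ y : Γ(𝒳.left, W),
      secRes 𝒳.left i₁ (G a b) * secRes 𝒳.left i₂ (G b d) =
        secRes 𝒳.left i₃ (G a d) + (p : Γ(𝒳.left, W)) ^ (m + 1) * y :=
    fun a b d W hW i₁ i₂ i₃ => UnitCocycle.exists_defect_of_app_eq (thickeningι 𝒳 (m + 1)) p (m + 1)
      (fun U hU => (cutOut' 𝒳 (m + 1) hU).2) A G hmulM a b d hW i₁ i₂ i₃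
  have hGH' : ∀ a b, ∃ e' : Γ(𝒳.left, A a ⊓ A b),
      G a b * H a b = 1 + (p : Γ(𝒳.left, A a ⊓ A b)) * e' := fun a b => by
    obtain ⟨e', he'⟩ := (cutOut' 𝒳 (m + 1) (isAffineOpen_inf 𝒳 _ _ (hA a) (hA b))).2
      (G a b * H a b - 1) (by rw [map_sub, map_one, sub_eq_zero, hGH])
    exact ⟨(p : Γ(𝒳.left, A a ⊓ A b)) ^ m * e', by linear_combination he'⟩
  have hGHW : ∀ (a b : Set.range (thickeningι 𝒳 1).base) {W : 𝒳.left.Opens} (i : W ≤ A a ⊓ A b),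
      ∃ e' : Γ(𝒳.left, W), secRes 𝒳.left i (G a b) * secRes 𝒳.left i (H a b) =
        1 + (p : Γ(𝒳.left, W)) * e' := fun a b W i => by
    obtain ⟨e', he'⟩ := hGH' a b
    have h := congrArg (secRes 𝒳.left i) he'
    simp only [map_mul, map_add, map_one, map_natCast] at h
    exact ⟨_, h⟩
  have hGHK : ∀ a b, ∃ e' : Γ(𝒳.left, A a ⊓ A b),
      G a b ^ (p ^ e * N) * H a b ^ (p ^ e * N) = 1 + (p : Γ(𝒳.left, A a ⊓ A b)) * e' := by
    intro a b
    obtain ⟨e', he'⟩ := hGH' a b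
    obtain ⟨e'', he''⟩ := exists_one_add_mul_pow_eq (p : Γ(𝒳.left, A a ⊓ A b)) e' (p ^ e * N)
    exact ⟨e'', by rw [← mul_pow, he', he'']⟩
  -- Step 1: `T = [G^{p^e N}]` is a class on `X_{m+e+1}` (transport of the defect, `p` odd)
  have hzT : ∀ V : (thickening 𝒳 (m + e + 1)).left.Opens,
      (p : Γ((thickening 𝒳 (m + e + 1)).left, V)) ^ (m + 1 + e) = 0 := fun V => by
    rw [Nat.add_right_comm m 1 e]
    exact p_pow_eq_zero 𝒳 (m + e + 1) V
  have killT : ∀ (U : 𝒳.left.Opens) (x y z : Γ(𝒳.left, U)),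
      (thickeningι 𝒳 (m + e + 1)).app U (x * (1 + (N : Γ(𝒳.left, U)) *
        (p : Γ(𝒳.left, U)) ^ (m + 1 + e) * y) + (p : Γ(𝒳.left, U)) ^ (m + 1 + e + 1) * z) =
        (thickeningι 𝒳 (m + e + 1)).app U x := fun U x y z => by
    simp only [map_add, map_mul, map_one, map_pow, map_natCast, pow_succ, hzT, zero_mul, mul_zero,
      add_zero, mul_one]
  have hmulT : ∀ (a b d : Set.range (thickeningι 𝒳 1).base) (i₁ : A a ⊓ A b ⊓ A d ≤ A a ⊓ A b)
      (i₂ : A a ⊓ A b ⊓ A d ≤ A b ⊓ A d) (i₃ : A a ⊓ A b ⊓ A d ≤ A a ⊓ A d),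
      (thickeningι 𝒳 (m + e + 1)).app _ (secRes 𝒳.left i₁ (G a b ^ (p ^ e * N)) *
        secRes 𝒳.left i₂ (G b d ^ (p ^ e * N))) =
        (thickeningι 𝒳 (m + e + 1)).app _ (secRes 𝒳.left i₃ (G a d ^ (p ^ e * N))) := by
    intro a b d i₁ i₂ i₃
    obtain ⟨y₀, hy₀⟩ :=
      hC a b d (isAffineOpen_inf 𝒳 _ _ (isAffineOpen_inf 𝒳 _ _ (hA a) (hA b)) (hA d)) i₁ i₂ i₃
    obtain ⟨ead, head⟩ := hGHW a d i₃
    obtain ⟨yt, z₁, z₂, -, h2⟩ := exists_transport_pow hp hp2 (Nat.le_add_left 1 m) e N hy₀ head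
    have key : secRes 𝒳.left i₁ (G a b ^ (p ^ e * N)) * secRes 𝒳.left i₂ (G b d ^ (p ^ e * N)) =
        secRes 𝒳.left i₃ (G a d ^ (p ^ e * N)) *
          (1 + (N : _) * (p : _) ^ (m + 1 + e) * yt) + (p : _) ^ (m + 1 + e + 1) * z₂ := by
      rw [map_pow, map_pow, map_pow, ← mul_pow]
      exact h2
    rw [key, killT]
  have hunitT : ∀ a, IsUnit ((thickeningι 𝒳 (m + e + 1)).app _ (G a a ^ (p ^ e * N))) := by
    intro a
    obtain ⟨e', he'⟩ := hGHK a a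
    exact isUnit_app_of_mul_eq _ ⟨m + e + 1, p_pow_eq_zero 𝒳 _ _⟩ he'
  obtain ⟨gT, hUT, hgT⟩ := UnitCocycle.exists_presented (thickeningι 𝒳 (m + e + 1)) πT A
    (fun a b => G a b ^ (p ^ e * N)) memT hmulT hunitT
  -- Step 2: `T|_{X_k} = (c|_{X_k})^{p^e N}` (on `X_k`, `p = 0` and `G` is an honest cocycle)
  have hzk : ∀ V, (p : Γ((specialFibre 𝒳).left, V)) = 0 := p_eq_zero_special 𝒳
  have hmulk : ∀ (a b d : Set.range (thickeningι 𝒳 1).base) (i₁ : A a ⊓ A b ⊓ A d ≤ A a ⊓ A b)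
      (i₂ : A a ⊓ A b ⊓ A d ≤ A b ⊓ A d) (i₃ : A a ⊓ A b ⊓ A d ≤ A a ⊓ A d),
      (specialFibreι 𝒳).app _ (secRes 𝒳.left i₁ (G a b) * secRes 𝒳.left i₂ (G b d)) =
        (specialFibreι 𝒳).app _ (secRes 𝒳.left i₃ (G a d)) := by
    intro a b d i₁ i₂ i₃
    obtain ⟨y₀, hy₀⟩ :=
      hC a b d (isAffineOpen_inf 𝒳 _ _ (isAffineOpen_inf 𝒳 _ _ (hA a) (hA b)) (hA d)) i₁ i₂ i₃
    have h0 : (specialFibreι 𝒳).app _ ((p : Γ(𝒳.left, A a ⊓ A b ⊓ A d)) ^ (m + 1) * y₀) = 0 := by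
      rw [map_mul, map_pow, map_natCast, hzk, zero_pow (Nat.succ_ne_zero m), zero_mul]
    rw [hy₀, map_add, h0, add_zero]
  have hunitk : ∀ a, IsUnit ((specialFibreι 𝒳).app _ (G a a)) := by
    intro a
    obtain ⟨e', he'⟩ := hGH' a a
    exact isUnit_app_of_mul_eq _ ⟨1, by rw [pow_one]; exact hzk _⟩ he'
  obtain ⟨gk, hUk, hgk⟩ :=
    UnitCocycle.exists_presented (specialFibreι 𝒳) πk A G memk hmulk hunitk
  obtain ⟨gkK, hUkK, hgkK, hpow⟩ :=
    CechPic.exists_presented_pow memk hmulk hunitk hUk hgk (p ^ e * N)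
  have hsT : CechPic.pullback (specialFibreToThickening 𝒳 (m + e)) (CechPic.mk gT) =
      CechPic.pullback (specialFibreToThickening 𝒳 m) c ^ (p ^ e * N) := by
    rw [CechPic.pullback_mk_presented (G := fun a b => G a b ^ (p ^ e * N))
        (specialFibreToThickening 𝒳 (m + e)) (thickeningι 𝒳 (m + e + 1))
        (specialFibreToThickening_ι 𝒳 (m + e)).symm πT hπkT memk hUkK hgkK hUT hgT, hpow, ← hcg,
      CechPic.pullback_mk_presented (specialFibreToThickening 𝒳 m) (thickeningι 𝒳 (m + 1))
        (specialFibreToThickening_ι 𝒳 m).symm πM hπkM memk hUk hgk hU hg]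
  -- Step 3: `T` extends to `X_{m+e+2}`: `T · (c'|_{X_{m+e+1}})⁻¹` dies on `X_k`
  have hu : CechPic.pullback (specialFibreToThickening 𝒳 (m + e)) (CechPic.mk gT *
      (CechPic.pullback (thickeningMap 𝒳 (Nat.le_succ (m + e + 1))) c')⁻¹) = 1 := by
    rw [map_mul, map_inv, hsT, ← CechPic.pullback_comp,
      specialFibreToThickening_comp_thickeningMap 𝒳 (Nat.le_succ (m + e + 1)), hc', mul_inv_cancel]
  obtain ⟨u', hu'⟩ := h2 _ hu
  have hlift : ∃ L : CechPic (thickening 𝒳 (m + e + 2)).left,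
      CechPic.pullback (thickeningMap 𝒳 (Nat.le_succ (m + e + 1))) L = CechPic.mk gT :=
    ⟨u' * c', by rw [map_mul, hu', inv_mul_cancel_right]⟩
  -- Step 4: hence the defect of `G^{p^e N}` modulo `p^{m+e+2}` is a coboundary on a refinement
  obtain ⟨A', hA', hle, hmemσ, v, hcob⟩ := UnitCocycle.exists_coboundary_of_lifts
    (thickeningMap 𝒳 (Nat.le_succ (m + e + 1))) (thickeningι 𝒳 (m + e + 2))
    (thickeningMap_ι 𝒳 (Nat.le_succ (m + e + 1))).symm (isInducing_ι 𝒳 _) (isInducing_ι 𝒳 _)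
    (isAffineOpen_inf 𝒳) p (m + e + 1) (Nat.succ_pos _) (fun U hU => (cutOut' 𝒳 (m + e + 1) hU).1)
    (fun U hU => (cutOut' 𝒳 (m + e + 1) hU).2) (fun U hU => (cutOut' 𝒳 (m + e + 2) hU).1)
    (fun U hU => (cutOut' 𝒳 (m + e + 2) hU).2) πT σT hπσT A (fun a b => G a b ^ (p ^ e * N))
    (fun a b => H a b ^ (p ^ e * N)) memT hGHK hUT hgT hlift
  have memS' : ∀ s : Set.range (thickeningι 𝒳 1).base, (s : 𝒳.left) ∈ A' s := fun s => by
    have h := hmemσ s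
    rwa [← hπT, hπσT] at h
  have memA'M : ∀ y, (thickeningι 𝒳 (m + 1)).base y ∈ A' (πM y) := fun y => by
    rw [← hπM]; exact memS' _
  have memA'M' : ∀ y, (thickeningι 𝒳 (m + 2)).base y ∈ A' (πM' y) := fun y => by
    rw [← hπM']; exact memS' _
  -- a prime-to-`p` inverse of `N`
  obtain ⟨α, -, hα⟩ := Nat.exists_mul_mod_eq_one_of_coprime
    ((Nat.Prime.coprime_iff_not_dvd hp).mpr hN).symm hp.one_lt
  have hBez : N * α = p * (N * α / p) + 1 := by
    nth_rw 1 [← Nat.div_add_mod (N * α) p]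
    rw [hα]
  -- Step 5: so the obstruction cochain of `c` is a coboundary, and `c` extends to `X_{m+2}`
  refine (UnitCocycle.exists_lift_of_coboundary (thickeningMap 𝒳 (Nat.le_succ (m + 1)))
    (thickeningι 𝒳 (m + 2)) (thickeningMap_ι 𝒳 _).symm p (m + 1) (Nat.succ_pos m)
    (p_pow_eq_zero 𝒳 (m + 1)) (fun V => p_pow_eq_zero 𝒳 (m + 2) V) πM πM' hπMM' A G H hGH'
    hU hg A' hle memA'M memA'M' (fun a b => (α : Γ(𝒳.left, A' a ⊓ A' b)) * v a b) ?_).imp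
    fun c'' hc'' => hc''.trans hcg
  intro a b d i₁ i₂ i₃ j₁ j₂ j₃
  have hW : IsAffineOpen (A' a ⊓ A' b ⊓ A' d) :=
    isAffineOpen_inf 𝒳 _ _ (isAffineOpen_inf 𝒳 _ _ (hA' a) (hA' b)) (hA' d)
  obtain ⟨y₀, hy₀⟩ := hC a b d hW i₁ i₂ i₃
  obtain ⟨ead, head⟩ := hGHW a d i₃
  obtain ⟨yt, z₁, z₂, h1, h2'⟩ := exists_transport_pow hp hp2 (Nat.le_add_left 1 m) e N hy₀ head
  obtain ⟨eK, heK⟩ := hGHK a d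
  have heK' := congrArg (secRes 𝒳.left i₃) heK
  simp only [map_mul, map_pow, map_add, map_one, map_natCast] at heK'
  obtain ⟨z, hz⟩ := hcob a b d i₁ i₂ i₃ j₁ j₂ j₃
  rw [map_pow, map_pow, map_pow, ← mul_pow, h2', Nat.add_right_comm m 1 e,
    mul_assoc (N : Γ(𝒳.left, A' a ⊓ A' b ⊓ A' d)),
    mul_left_comm (N : Γ(𝒳.left, A' a ⊓ A' b ⊓ A' d))] at hz
  obtain ⟨d₇, hd₇⟩ :=
    exists_eq_add_mul_of_defect_eq (mul_p_injective_sections 𝒳 _) (m + e + 1) heK' hz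
  obtain ⟨z', hz'⟩ := exists_defect_descend hBez h1 hd₇
  refine ⟨z', ?_⟩
  simp only [map_mul, map_natCast]
  linear_combination hz'

end Summit.HodgeConjecture.HodgeConjecture.Theorems.FormalLiftingFromClassLifting.WeightOne

end
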